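import Summits.QuantumFields.YangMills.Theorems.UnitScaleTiltProp7QTwSCentralTowerRows
import Summits.QuantumFields.YangMills.Theorems.UnitScaleTiltProp7SectET3Transport
import Literature.MathematicalPhysics.QuantumFieldTheory.Balaban1983to89.B11Eq115Space
import HarnessLib

/-!
# Route `UnitScaleTilt`, crux K1 child «MinimiserStabilityRegPr» (stmt-QuantumFields-19200), stub `stub_existenceMinimalOrbit` (EX), route (α) — **(Z-C) «CHART-CENTRAL»: THE RE-BASED TWISTED
# REMAINDER `C(U₀, A) = log U̿ˢ(A) − Q(U₀)A` IS INVARIANT UNDER CENTRAL TRANSLATIONS** — `CmapTwS U₀ (A + (iz)·1) = CmapTwS U₀ A` at `U₀ ∈ 𝔘_k(ε₀)` on the ball `‖A‖ < η∕(10⁹L²)`,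
# `32ℓLᵏt ≤ 1`; and the (W-X′) reading: the A-units chart remainder `C̃ U₀ := fun A′ ↦ (−I) • CmapTwS U₀ ((η·I) • ιA′)` satisfies ✓`Prop7SectET3WCurrentReality`'s displayed row `hZC`
# at `c₄ := e∕2`, `δ := (160·L)⁻¹`

Cell `ym3-torus`, width seat `ym3-torus-px3` (gen 3; EX namer ★w2-19200 g7 WORD (9) 2026-08-28T23:58:13Z «(Z-C) CHART-CENTRAL GO»).  THEOREMS ONLY (0 `def`, 0 `sorry`); `--supports
stmt-QuantumFields-19200 --as helper`; count-neutral.  YM₃ on T³ is a ladder rung (R3), NOT the Clay problem; nothing here claims the stub, the crux, d = 4 or the mass gap.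

THE PRINT.  [Balaban1985BackgroundPropagators] (3.14)–(3.15) p. 393 (`C_j(U, A) = Q_j(U, A) − Q_j(U)A`); [Balaban1985Averaging] (125)–(127) p. 36, Prop. 4 (134)–(135) p. 38 (the linear averaging on
the abelian part); [Balaban1985Variational] (44) p. 285, (51) p. 286.  MECHANISM (all landed, ★w5-20520 g5's J-term lineage): the twisted log-chart is ADDITIVE in central directions —
✓`Prop7SymAvgTwSym.logChartTwS_add_central` (`log U̿ˢ(A + (iz)·1)(c) = log U̿ˢ(A)(c) + (i·Lᵏ·(Q_k z)(ĉ))·1`, modulo tower rows), the tower rows hold at `U₀ ∈ 𝔘_k(ε₀)` on the ball `‖A‖ < η∕(10⁹L²)`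
(✓`towerRows_of_regPr`, whose proof is repeated here with the radius EXPLICIT — its statement hides it behind `∃ ρ`), `‖U̿ˢ(A) − 1‖ ≤ 1∕8` there (✓`norm_dbarTwS_sub_one_le_eighth_of_regPr`), and the
linear part takes the SAME value on the centre (✓`QTwS_apply_smul_one_of_regPr`: `Q(U₀)(c·1) = (Lᵏ·Q_k c)·1`) — so the remainder does not move.

WHAT IS PROVED (sorry-free, no definition).
* §1 `towerRows_of_regPr_ball` — ✓`towerRows_of_regPr` with the radius `(10⁹L²)⁻¹·η` in the statement (same proof, verbatim).
* §2 ★★ **`CmapTwS_add_central_of_regPr`** — `CmapTwS F n K h U₀ (fun b ↦ A b + (I·z b)•1) = CmapTwS F n K h U₀ A` for `RegPr F n K ε₀ U₀`, `10¹²L³ε₀ ≤ 1`, `‖A‖ < (10⁹L²)⁻¹·η`, `|z(b)| ≤ t`,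
  `32ℓLᵏt ≤ 1`.
* §3 ★★★ **`Ctilde_add_central_of_regPr`** — the binder `hZC` of ✓`Prop7SectET3WCurrentReality.W80_isHermitian_trace_zero_of_rows` ∕ ✓`…AtRecord.W80_isHermitian_trace_zero_at_record` VERBATIM at
  `c₄ := e∕2`, `δ := (160·(F.L))⁻¹`: for `‖Y‖ < e∕2` in the space (115) and every `z` with central readings and `‖z‖ < (160·L)⁻¹`, `C̃ (Y + z) = C̃ Y` (weights `1` at `lev ≡ K − n`, `Lᵏη = 1`,
  `ℓ = 5L` at `d = 3`, `10⁹L²e ≤ 1`).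
HONEST SCOPE.  A corollary of landed theorems with explicit numerals; nothing of [Balaban1985Averaging] ∕ [Balaban1985BackgroundPropagators] is asserted; the EX stub is not touched.

References: T. Bałaban, CMP **99** (1985) 389–434 [Balaban1985BackgroundPropagators] ((3.13)–(3.15) p.393); CMP **98** (1985) 17–51 [Balaban1985Averaging] ((89)–(92) p.31, (125)–(127) p.36,
Prop. 4 (134)–(135) p.38, (161)–(163) p.42); CMP **95** (1984) 17–40 [Balaban1984PropagatorsI] ((1.18) p.20); CMP **102** (1985) 277–309 [Balaban1985Variational] ((44) p.285, (51) p.286, (115) p.294).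
-/

set_option autoImplicit false

noncomputable section

open scoped Matrix.Norms.L2Operator
open Filter Topology Metric

namespace Summit.QuantumFields.YangMills.Theorems.Prop7SymAvgTwSym

open NormedSpace
open Literature.MathematicalPhysics.QuantumFieldTheory.Balaban1983to89
open T4Continuum BlockAveraging AveragingRT ExpMeanLog MatrixLog BlockAveragingEMLLinearised LatticeFieldCalculus
open B10Eq27TorusAxialLog (holT unitsField toUField)
open B7Prop1Explicit (expUnit U1 mem_U1)
open T3ContinuumYM3Torus
open T3LevelShift (bondShift)
open T3PrintedRegularOrbits (sites_eq)
open T3PrintedRegularMinimiser (RegPr)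
open T3SectALandauChart (eta eta_pos bgUnits)
open B9SectCLatticeCarrier (Bond)
open B11Eq115Space (NegSup NegSize Space115 JetSup levWeight)
open B11Eq111FrakG (nabla115)
open Summit.QuantumFields.YangMills.Theorems.Prop8Chart (loopHolU emlIterU expCfg)
open Summit.QuantumFields.YangMills.Theorems.Prop8ChartDoubleBar (dbarIterU bondAvgIter_const_mul)
open Summit.QuantumFields.YangMills.Theorems.Prop7CmapTwInputs (norm_apply_le_of_mem_ball)
open Summit.QuantumFields.YangMills.Theorems.Prop7SectET3Transport (periodsT3 siteEquiv bondEquiv bgOfCfg levWeight_const_eq_one)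

section T3

variable (F : T3Family) {n K : ℕ} (h : n ≤ K)

/-! ## §1 The tower rows at `U₀ ∈ 𝔘_k(ε₀)` with the radius explicit -/

/-- **✓`towerRows_of_regPr` WITH THE RADIUS IN THE STATEMENT**: at `U₀ ∈ 𝔘_k(ε₀)` (`10¹²L³ε₀ ≤ 1`), for `‖A‖ < (10⁹L²)⁻¹·η`, at every level `j < K − n` the loop variables of the perturbed
covariant tower and its twisted stair transporters against the background tower are within `1∕8` of `1` (proof = ✓`towerRows_of_regPr`'s, verbatim).
[cite: Balaban1985Averaging, (89)-(92) p.31, (161)-(163) p.42; Balaban1987RG1, (0.3)-(0.4) pp.252-253] -/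
theorem towerRows_of_regPr_ball {ε₀ : ℝ} (hε₀ : 0 < ε₀) (hWε : 10 ^ 12 * (F.L : ℝ) ^ 3 * ε₀ ≤ 1)
    (U₀ : GaugeField (F.P K) 0 (Matrix.specialUnitaryGroup (Fin 2) ℂ)) (hreg : RegPr F n K ε₀ U₀)
    (A : PBond (F.P K) 0 → Matrix (Fin 2) (Fin 2) ℂ) (hA : ‖A‖ < (10 ^ 9 * (F.L : ℝ) ^ 2)⁻¹ * eta F n K) :
    (∀ j, j < K - n → ∀ (c : PBond (F.P K) (j + 1)) (i : Idx (F.P K)),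
        ‖((loopHolU (dbarCovIterU j (bgUnits F K U₀) (fun b => expUnit (A b) * bgUnits F K U₀ b)) c i : (Matrix (Fin 2) (Fin 2) ℂ)ˣ) : Matrix (Fin 2) (Fin 2) ℂ) - 1‖ ≤ 1 / 8) ∧
      (∀ j, j < K - n → ∀ (y : Site (F.P K) (j + 1)) (i : Idx (F.P K)),
        ‖((tstairU (emlIterU j (bgUnits F K U₀)) (dbarCovIterU j (bgUnits F K U₀) (fun b => expUnit (A b) * bgUnits F K U₀ b)) y i : (Matrix (Fin 2) (Fin 2) ℂ)ˣ) :
          Matrix (Fin 2) (Fin 2) ℂ) - 1‖ ≤ 1 / 8) := by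
  have hd : (F.P K).d = 3 := T3Family.P_d F K
  have hLL : ((F.P K).L : ℝ) = F.L := rfl
  have hL3 : 3 ≤ F.L := by obtain ⟨a, ha⟩ := F.hL.1; have := F.hL.2; omega
  have hL1 : (1 : ℝ) ≤ F.L := by exact_mod_cast (show 1 ≤ F.L by omega)
  have hε7 : 10 ^ 7 * (F.L : ℝ) ^ 3 * ε₀ ≤ 1 := by
    have h1 : (0 : ℝ) ≤ (F.L : ℝ) ^ 3 * ε₀ := by positivity
    nlinarith
  set e : ℝ := (10 ^ 9 * (F.L : ℝ) ^ 2)⁻¹ with he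
  have hpos : (0 : ℝ) < 10 ^ 9 * (F.L : ℝ) ^ 2 := by positivity
  have he0 : 0 < e := by rw [he]; exact inv_pos.2 hpos
  have hWe : 10 ^ 9 * (F.L : ℝ) ^ 2 * e ≤ 1 := by rw [he, mul_inv_cancel₀ hpos.ne']
  have hℓ : ((((F.P K).d + 2) * (F.P K).L : ℕ) : ℝ) = 5 * (F.L : ℝ) := by
    rw [hd, ← hLL]; push_cast; ring
  -- the numerics: `r := 3(2e + 2700Lε₀) ≤ ½`, `δ := 2r`, `2ℓδ ≤ 1/16`
  set r : ℝ := 3 * (2 * e + 2700 * (F.L : ℝ) * ε₀) with hr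
  have hr0 : 0 ≤ r := by positivity
  have he9 : 10 ^ 9 * ((F.L : ℝ) * e) ≤ 1 := by
    have hL12 : (F.L : ℝ) ≤ (F.L : ℝ) ^ 2 := by nlinarith
    have : (F.L : ℝ) * e ≤ (F.L : ℝ) ^ 2 * e := mul_le_mul_of_nonneg_right hL12 he0.le
    nlinarith
  have hLε : 10 ^ 12 * ((F.L : ℝ) ^ 2 * ε₀) ≤ 1 := by
    have : (F.L : ℝ) ^ 2 * ε₀ ≤ (F.L : ℝ) ^ 3 * ε₀ := mul_le_mul_of_nonneg_right (pow_le_pow_right₀ hL1 (by norm_num : 2 ≤ 3)) hε₀.le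
    linarith
  have hnum : 2 * ((((F.P K).d + 2) * (F.P K).L : ℕ) : ℝ) * (2 * r) ≤ 1 / 16 := by
    rw [hℓ, hr]
    have e1 : 2 * (5 * (F.L : ℝ)) * (2 * (3 * (2 * e + 2700 * (F.L : ℝ) * ε₀))) = 120 * ((F.L : ℝ) * e) + 162000 * ((F.L : ℝ) ^ 2 * ε₀) := by ring
    rw [e1]; nlinarith
  have hr2 : r ≤ 1 / 2 := by
    have hℓ1 : (1 : ℝ) ≤ 2 * ((((F.P K).d + 2) * (F.P K).L : ℕ) : ℝ) := by rw [hℓ]; linarith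
    nlinarith
  have hAb : ∀ b, ‖A b‖ ≤ e * eta F n K := norm_apply_le_of_mem_ball F hA
  -- per level: the background tower is `U1`-valued, the perturbed tower `r`-close to it relatively
  have hV : ∀ j, j < K - n → ∀ b : PBond (F.P K) j, emlIterU j (bgUnits F K U₀) b ∈ U1 (Matrix (Fin 2) (Fin 2) ℂ) :=
    fun j hj b => emlIterU_bgUnits_mem_U1_of_regPr F hε₀ hε7 hreg hj.le b
  have hrel : ∀ j, j < K - n → ∀ b : PBond (F.P K) j,
      ‖((dbarCovIterU j (bgUnits F K U₀) (fun b => expUnit (A b) * bgUnits F K U₀ b) b : (Matrix (Fin 2) (Fin 2) ℂ)ˣ) : Matrix (Fin 2) (Fin 2) ℂ) *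
          (((emlIterU j (bgUnits F K U₀) b)⁻¹ : (Matrix (Fin 2) (Fin 2) ℂ)ˣ) : Matrix (Fin 2) (Fin 2) ℂ) - 1‖ ≤ r :=
    fun j hj b => norm_dbarCovIterU_rel_sub_one_le_of_regPr F hε₀ he0.le hWe hWε U₀ hreg A hAb hj.le b
  have h₁ : ∀ j, j < K - n → ∀ b : PBond (F.P K) j,
      ‖((dbarCovIterU j (bgUnits F K U₀) (fun b => expUnit (A b) * bgUnits F K U₀ b) b : (Matrix (Fin 2) (Fin 2) ℂ)ˣ) : Matrix (Fin 2) (Fin 2) ℂ) -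
          ((emlIterU j (bgUnits F K U₀) b : (Matrix (Fin 2) (Fin 2) ℂ)ˣ) : Matrix (Fin 2) (Fin 2) ℂ)‖ ≤ 2 * r :=
    fun j hj b => (norm_sub_le_of_rel (hV j hj b) (hrel j hj b)).trans (by linarith)
  have h₂ : ∀ j, j < K - n → ∀ b : PBond (F.P K) j,
      ‖(((dbarCovIterU j (bgUnits F K U₀) (fun b => expUnit (A b) * bgUnits F K U₀ b) b)⁻¹ : (Matrix (Fin 2) (Fin 2) ℂ)ˣ) : Matrix (Fin 2) (Fin 2) ℂ) -
          (((emlIterU j (bgUnits F K U₀) b)⁻¹ : (Matrix (Fin 2) (Fin 2) ℂ)ˣ) : Matrix (Fin 2) (Fin 2) ℂ)‖ ≤ 2 * r :=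
    fun j hj b => norm_inv_sub_inv_le_of_rel (hV j hj b) hr2 (hrel j hj b)
  have hδ0 : 0 ≤ 2 * r := by positivity
  have hℓδ : 2 * ((((F.P K).d + 2) * (F.P K).L : ℕ) : ℝ) * (2 * r) ≤ 1 := hnum.trans (by norm_num)
  refine ⟨fun j hj c i => ?_, fun j hj y i => ?_⟩
  · have h1 := norm_loopHolU_sub_one_le_of_rel _ _ hδ0 (hV j hj) (h₁ j hj) (h₂ j hj) hℓδ c i
    have h2 := loopHolU_emlIterU_bgUnits_le_sixteenth_of_regPr F hε₀ hε7 hreg j hj c i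
    linarith
  · exact (norm_tstairU_sub_one_le_of_rel _ _ hδ0 (hV j hj) (h₁ j hj) (h₂ j hj) hℓδ y i).trans (hnum.trans (by norm_num))


/-! ## §2 ★★ The remainder is invariant under central translations -/

/-- ★★ **(Z-C) — `C(U₀, A + (iz)·1) = C(U₀, A)`**: the twisted log-chart shifts by `(i·Lᵏ·(Q_k z))·1` (✓`logChartTwS_add_central` with §1's rows and ✓`norm_dbarTwS_sub_one_le_eighth_of_regPr`) and so does
its linear part (✓`QTwS_apply_smul_one_of_regPr` at `c := i·z`, ✓`bondAvgIter_const_mul`), at `U₀ ∈ 𝔘_k(ε₀)` (`10¹²L³ε₀ ≤ 1`) on `‖A‖ < (10⁹L²)⁻¹·η`, `|z(b)| ≤ t`, `32ℓLᵏt ≤ 1`.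
[cite: Balaban1985BackgroundPropagators, (3.14)-(3.15) p.393; Balaban1985Averaging, (125)-(127) p.36, Prop. 4 (134)-(135) p.38; Balaban1985Variational, (44) p.285, (51) p.286] -/
theorem CmapTwS_add_central_of_regPr {ε₀ : ℝ} (hε₀ : 0 < ε₀) (hWε : 10 ^ 12 * (F.L : ℝ) ^ 3 * ε₀ ≤ 1)
    (U₀ : GaugeField (F.P K) 0 (Matrix.specialUnitaryGroup (Fin 2) ℂ)) (hreg : RegPr F n K ε₀ U₀)
    (A : PBond (F.P K) 0 → Matrix (Fin 2) (Fin 2) ℂ) (hA : ‖A‖ < (10 ^ 9 * (F.L : ℝ) ^ 2)⁻¹ * eta F n K)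
    (z : PBond (F.P K) 0 → ℂ) {t : ℝ} (ht0 : 0 ≤ t)
    (hsmall : 32 * ((((F.P K).d + 2) * (F.P K).L : ℕ) : ℝ) * (((F.P K).L : ℝ) ^ (K - n) * t) ≤ 1) (hz : ∀ b, ‖z b‖ ≤ t) :
    CmapTwS F n K h U₀ (fun b => A b + (Complex.I * z b) • (1 : Matrix (Fin 2) (Fin 2) ℂ)) = CmapTwS F n K h U₀ A := by
  obtain ⟨hWl, hT⟩ := towerRows_of_regPr_ball F hε₀ hWε U₀ hreg A hA
  have hlin : QTwS F n K h U₀ (fun b => A b + (Complex.I * z b) • (1 : Matrix (Fin 2) (Fin 2) ℂ))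
      = QTwS F n K h U₀ A + QTwS F n K h U₀ (fun b => (Complex.I * z b) • (1 : Matrix (Fin 2) (Fin 2) ℂ)) := by
    rw [← map_add]; rfl
  have hQ := QTwS_apply_smul_one_of_regPr F h hε₀ hWε U₀ hreg (fun b => Complex.I * z b)
  funext c
  rw [CmapTwS_apply, CmapTwS_apply, Pi.sub_apply, Pi.sub_apply, hlin, Pi.add_apply, hQ,
    logChartTwS_add_central F h U₀ A z ht0 hsmall hz hWl hT c (norm_dbarTwS_sub_one_le_eighth_of_regPr F h hε₀ hWε U₀ hreg hA c)]
  simp only [bondAvgIter_const_mul]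
  have hc : Complex.I * ((((F.P K).L : ℂ)) ^ (K - n) * bondAvgIter (K - n) z (bondShift (sites_eq F n K h) c))
      = (((F.P K).L : ℂ)) ^ (K - n) * (Complex.I * bondAvgIter (K - n) z (bondShift (sites_eq F n K h) c)) := by ring
  rw [hc]
  abel

/-! ## §3 ★★★ The (W-X′) reading: the row `hZC` of the `hWR` door, discharged -/

/-- ★★★ **THE DISPLAYED ROW `hZC` OF ✓`W80_isHermitian_trace_zero_of_rows` ∕ ✓`…_at_record`, DISCHARGED at `U₀ ∈ 𝔘_k(ε₀)` in the windows `10⁹L²e ≤ 1`, `10¹²L³ε₀ ≤ 1`** (`c₄ := e∕2`,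
`δ := (160·L)⁻¹`): the A-units chart remainder `C̃ U₀ := fun A′ ↦ (−I) • CmapTwS U₀ ((η·I) • ιA′)` is invariant under every translation by a (115)-field with central readings of norm
`< (160·L)⁻¹`, on the ball `‖Y‖ < e∕2` — §2 at `A := (η·I)•ιY` (`‖A‖ ≤ η‖Y‖ < η∕(2·10⁹L²)`, the (115)-weights are `1`), `z(b) := η·c(b)` (`‖z(b)‖ ≤ η‖z‖`), `t := η‖z‖`, `Lᵏη = 1`, `ℓ = 5L`.
[cite: Balaban1985Variational, (44) p.285, (51) p.286, (115) p.294; Balaban1985BackgroundPropagators, (3.14)-(3.15) p.393] -/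
theorem Ctilde_add_central_of_regPr [Fact (0 < (F.L : ℝ))] [Fact (0 < ((F.L : ℝ)⁻¹) ^ (K - n))]
    {ε₀ e : ℝ} (hε₀ : 0 < ε₀) (he : 0 < e) (hWe : 10 ^ 9 * (F.L : ℝ) ^ 2 * e ≤ 1) (hWε : 10 ^ 12 * (F.L : ℝ) ^ 3 * ε₀ ≤ 1)
    (U₀ : GaugeField (F.P K) 0 (Matrix.specialUnitaryGroup (Fin 2) ℂ)) (hreg : RegPr F n K ε₀ U₀) :
    ∀ Y : Space115 (F.L : ℝ) (((F.L : ℝ)⁻¹) ^ (K - n)) (fun _ : Bond 3 (periodsT3 F K) => K - n)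
        (fun _ : Bond 3 (periodsT3 F K) × Fin 3 => K - n) (nabla115 (((F.L : ℝ)⁻¹) ^ (K - n)) (bgOfCfg F K U₀)), ‖Y‖ < e / 2 →
      ∀ z : Space115 (F.L : ℝ) (((F.L : ℝ)⁻¹) ^ (K - n)) (fun _ : Bond 3 (periodsT3 F K) => K - n)
        (fun _ : Bond 3 (periodsT3 F K) × Fin 3 => K - n) (nabla115 (((F.L : ℝ)⁻¹) ^ (K - n)) (bgOfCfg F K U₀)),
        (∀ b, ∃ c : ℂ, JetSup.equiv _ _ _ z b = c • (1 : Matrix (Fin 2) (Fin 2) ℂ)) → ‖z‖ < (160 * (F.L : ℝ))⁻¹ →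
        (-Complex.I) • CmapTwS F n K h U₀ (((((eta F n K : ℝ) : ℂ)) * Complex.I) • fun b : PBond (F.P K) 0 => JetSup.equiv _ _ _ (Y + z) (bondEquiv F K b))
          = (-Complex.I) • CmapTwS F n K h U₀ (((((eta F n K : ℝ) : ℂ)) * Complex.I) • fun b : PBond (F.P K) 0 => JetSup.equiv _ _ _ Y (bondEquiv F K b)) := by
  intro Y hY z hz hzδ
  have hL : (F.L : ℝ) ≠ 0 := (Fact.out : 0 < (F.L : ℝ)).ne'
  have hLpos : (0 : ℝ) < F.L := Fact.out
  have hη : 0 < eta F n K := eta_pos F n K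
  -- the central readings of `z`
  choose c hc using hz
  -- the 0-jets are pointwise below the (115)-norms (weights `1`)
  have hpt : ∀ (X : Space115 (F.L : ℝ) (((F.L : ℝ)⁻¹) ^ (K - n)) (fun _ : Bond 3 (periodsT3 F K) => K - n)
      (fun _ : Bond 3 (periodsT3 F K) × Fin 3 => K - n) (nabla115 (((F.L : ℝ)⁻¹) ^ (K - n)) (bgOfCfg F K U₀))) (b : Bond 3 (periodsT3 F K)),
      ‖JetSup.equiv _ _ _ X b‖ ≤ ‖X‖ := fun X b => by
    have h1 := NegSup.norm_apply_le (JetSup.fst X) b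
    rw [JetSup.equiv_fst, levWeight_const_eq_one hL, inv_one, one_mul] at h1
    exact h1.trans (JetSup.norm_fst_le X)
  -- the letters of §2: `A := (η·I)•ιY`, `z′(b) := η·c(b̂)`, `t := η‖z‖`
  set A : PBond (F.P K) 0 → Matrix (Fin 2) (Fin 2) ℂ := ((((eta F n K : ℝ) : ℂ)) * Complex.I) • fun b : PBond (F.P K) 0 => JetSup.equiv _ _ _ Y (bondEquiv F K b) with hAdef
  have hsplit : (((((eta F n K : ℝ) : ℂ)) * Complex.I) • fun b : PBond (F.P K) 0 => JetSup.equiv _ _ _ (Y + z) (bondEquiv F K b))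
      = fun b => A b + (Complex.I * ((eta F n K : ℂ) * c (bondEquiv F K b))) • (1 : Matrix (Fin 2) (Fin 2) ℂ) := by
    funext b
    rw [hAdef, Pi.smul_apply, Pi.smul_apply, JetSup.equiv_add, Pi.add_apply, hc, smul_add, smul_smul]
    congr 1
    ring_nf
  -- the radius: `‖A‖ ≤ η‖Y‖ < η·e∕2 ≤ (10⁹L²)⁻¹·η`
  have hAn : ‖A‖ < (10 ^ 9 * (F.L : ℝ) ^ 2)⁻¹ * eta F n K := by
    have hAb : ∀ b, ‖A b‖ ≤ eta F n K * ‖Y‖ := fun b => by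
      rw [hAdef, Pi.smul_apply, norm_smul, norm_mul, Complex.norm_real, Complex.norm_I, mul_one, Real.norm_of_nonneg hη.le]
      exact mul_le_mul_of_nonneg_left (hpt Y _) hη.le
    have h1 : ‖A‖ ≤ eta F n K * ‖Y‖ := (pi_norm_le_iff_of_nonneg (by positivity)).2 hAb
    have hpos : (0 : ℝ) < 10 ^ 9 * (F.L : ℝ) ^ 2 := by positivity
    have he' : e ≤ (10 ^ 9 * (F.L : ℝ) ^ 2)⁻¹ := by
      rw [le_inv_comm₀ he hpos]
      calc 10 ^ 9 * (F.L : ℝ) ^ 2 = (10 ^ 9 * (F.L : ℝ) ^ 2 * e) * e⁻¹ := by field_simp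
        _ ≤ 1 * e⁻¹ := mul_le_mul_of_nonneg_right hWe (inv_nonneg.2 he.le)
        _ = e⁻¹ := one_mul _
    calc ‖A‖ ≤ eta F n K * ‖Y‖ := h1
      _ < eta F n K * (e / 2) := mul_lt_mul_of_pos_left hY hη
      _ ≤ eta F n K * (10 ^ 9 * (F.L : ℝ) ^ 2)⁻¹ := mul_le_mul_of_nonneg_left (by linarith) hη.le
      _ = (10 ^ 9 * (F.L : ℝ) ^ 2)⁻¹ * eta F n K := mul_comm _ _
  -- the central amplitudes: `‖η·c(b̂)‖ ≤ η‖z‖`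
  have hzb : ∀ b : PBond (F.P K) 0, ‖(eta F n K : ℂ) * c (bondEquiv F K b)‖ ≤ eta F n K * ‖z‖ := fun b => by
    rw [norm_mul, Complex.norm_real, Real.norm_of_nonneg hη.le]
    refine mul_le_mul_of_nonneg_left ?_ hη.le
    have h1 : ‖c (bondEquiv F K b) • (1 : Matrix (Fin 2) (Fin 2) ℂ)‖ = ‖c (bondEquiv F K b)‖ := by rw [norm_smul, CStarRing.norm_one, mul_one]
    rw [← h1, ← hc]
    exact hpt z _
  -- the window `32ℓLᵏt ≤ 1` at `t := η‖z‖`: `Lᵏη = 1`, `ℓ = 5L`, `‖z‖ < (160L)⁻¹`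
  have hd : (F.P K).d = 3 := T3Family.P_d F K
  have hLL : ((F.P K).L : ℝ) = F.L := rfl
  have hLη : ((F.P K).L : ℝ) ^ (K - n) * eta F n K = 1 := by
    rw [hLL, show eta F n K = ((F.L : ℝ)⁻¹) ^ (K - n) from rfl, ← mul_pow, mul_inv_cancel₀ hL, one_pow]
  have hsmall : 32 * ((((F.P K).d + 2) * (F.P K).L : ℕ) : ℝ) * (((F.P K).L : ℝ) ^ (K - n) * (eta F n K * ‖z‖)) ≤ 1 := by
    have hℓ : ((((F.P K).d + 2) * (F.P K).L : ℕ) : ℝ) = 5 * (F.L : ℝ) := by rw [hd, ← hLL]; push_cast; ring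
    rw [hℓ, ← mul_assoc (((F.P K).L : ℝ) ^ (K - n)), hLη, one_mul]
    have h160 : (0 : ℝ) < 160 * (F.L : ℝ) := by positivity
    have h1 : ‖z‖ * (160 * (F.L : ℝ)) ≤ 1 := by
      have := mul_le_mul_of_nonneg_right hzδ.le h160.le
      rwa [inv_mul_cancel₀ h160.ne'] at this
    nlinarith [norm_nonneg z]
  rw [hsplit, CmapTwS_add_central_of_regPr F h hε₀ hWε U₀ hreg A hAn (fun b => (eta F n K : ℂ) * c (bondEquiv F K b)) (by positivity) hsmall hzb]

end T3

end Summit.QuantumFields.YangMills.Theorems.Prop7SymAvgTwSym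

end
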